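import Summits.Ventures.YMGap.Thresholds.LatticeBakryEmeryGroundState
import Literature.MathematicalPhysics.QuantumFieldTheory.LatticeYangMillsBakryEmery
import HarnessLib

/-!
# Venture YMGap — multi-link Bakry–Émery calculus, Part I:
# the Wilson action as a polynomial potential on `(E⁺(Λ_L) → M_N(ℂ))` and its Hessian hypothesis

HONEST FRAMING: venture file (cell `pub-ymgap`, track (a), seat p2). Bookkeeping that feeds the
lattice Yang–Mills measure into the kernel multi-link Bakry–Émery Poincaré inequality
(`poincare_gibbs_lipschitz`): on the torus `Λ_L = (ℤ/L)^d` with positively oriented links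
`E = Edge d L`,

* `wilsonPot β Q = Nβ ∑_p Re tr(Q_{e₁} Q_{e₂} Q_{e₃}ᴴ Q_{e₄}ᴴ)` is a real polynomial of degree `≤ 4`
  in the real coordinates (`wilsonPot_mem_polySpace`; via complex-polynomial matrix-valued maps),
* on `SU(N)^E` it is the Wilson weight at tree ('t Hooft) coupling `Nβ` up to an additive constant:
  `-(Nβ) · wilsonAction ρ U = wilsonPot β (emb U) - N²β |P|` (`neg_mul_wilsonAction_eq`),
* `HessBound (wilsonPot β) (N|β|Λ₀)` follows from the tree's torus Hessian hypothesis
  `WilsonHessianBound d N Λ₀` (left-invariant second derivative `D_V D_V` at `Q ∈ SU(N)^E` = second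
  derivative along `t ↦ Q e^{tV} = e^{tX} Q`, `X_e = Q_e V_e Q_eᴴ`, `‖X_e‖_F = ‖V_e‖_F`)
  (`hessBound_wilsonPot`); with the venture's kernel theorem `wilsonHessianBound_four_d` this is
  `Λ = 4dN|β|`, i.e. `K = N/2 - 4dN|β|`.

## References

* H. Shen, R. Zhu, X. Zhu, CMP 400 (2023) 805–851, (1.1), Lemma 4.1, (4.7).
* Tree files `LatticeYangMillsBakryEmery.lean` (`WilsonHessianBound`), `ConstructiveQFTWave0.lean`
  (`wilsonAction`, `wilsonMeasure`).
-/

noncomputable section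

open scoped Matrix ComplexConjugate BigOperators Matrix.Norms.Frobenius ContDiff Topology
open Matrix Complex Finset MeasureTheory Filter
open Literature.MathematicalPhysics.QuantumFieldTheory
open Literature.MathematicalPhysics.QuantumLattice (fundamentalRep)
open Literature.MathematicalPhysics.QuantumFieldTheory.SUNBakryEmery
  (FrameIdx frame SUN CoordIdx coordFn coordFn_true coordFn_false)

namespace Summit.Ventures.YMGap

namespace LatticeBakryEmery

universe u

section CPoly

variable {ι : Type u} [Fintype ι] [DecidableEq ι] {N : ℕ}

/-! ### Complex-valued polynomial maps (both real and imaginary parts in `𝒫_n`) -/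

/-- A complex-valued map on `(E → M_N(ℂ))` is polynomial of degree `≤ n` if its real and imaginary
parts lie in `𝒫_n`. -/
def IsCPoly (n : ℕ) (f : Cfg ι N → ℂ) : Prop :=
  (fun Q => (f Q).re) ∈ polySpace ι N n ∧ (fun Q => (f Q).im) ∈ polySpace ι N n

omit [Fintype ι] [DecidableEq ι] in
/-- Matrix entries of a link are polynomial of degree `1`. -/
theorem isCPoly_entry (e : ι) (a b : Fin N) : IsCPoly (ι := ι) 1 fun Q => Q e a b := by
  refine ⟨?_, ?_⟩
  · have h := pcoordFn_mem_polySpace (ι := ι) (N := N) (n := 1) le_rfl (e, (a, b, true))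
    have e1 : pcoordFn (ι := ι) (N := N) (e, (a, b, true)) = fun Q => (Q e a b).re := by
      funext Q; rw [pcoordFn_apply, coordFn_true]
    rwa [e1] at h
  · have h := pcoordFn_mem_polySpace (ι := ι) (N := N) (n := 1) le_rfl (e, (a, b, false))
    have e1 : pcoordFn (ι := ι) (N := N) (e, (a, b, false)) = fun Q => (Q e a b).im := by
      funext Q; rw [pcoordFn_apply, coordFn_false]
    rwa [e1] at h

omit [Fintype ι] [DecidableEq ι] in
/-- Complex conjugates of polynomial maps are polynomial. -/
theorem IsCPoly.conj {n : ℕ} {f : Cfg ι N → ℂ} (hf : IsCPoly n f) : IsCPoly n fun Q => conj (f Q) := by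
  refine ⟨?_, ?_⟩
  · have : (fun Q => (conj (f Q)).re) = fun Q => (f Q).re := by funext Q; simp
    rw [this]; exact hf.1
  · have : (fun Q => (conj (f Q)).im) = (-1 : ℝ) • fun Q => (f Q).im := by
      funext Q; simp
    rw [this]; exact Submodule.smul_mem _ _ hf.2

omit [Fintype ι] [DecidableEq ι] in
/-- Products of polynomial maps are polynomial, degrees add. -/
theorem IsCPoly.mul {a b : ℕ} {f g : Cfg ι N → ℂ} (hf : IsCPoly a f) (hg : IsCPoly b g) :
    IsCPoly (a + b) fun Q => f Q * g Q := by
  refine ⟨?_, ?_⟩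
  · have : (fun Q => (f Q * g Q).re) =
        (fun Q => (f Q).re) * (fun Q => (g Q).re) - (fun Q => (f Q).im) * (fun Q => (g Q).im) := by
      funext Q; simp [Complex.mul_re]
    rw [this]
    exact Submodule.sub_mem _ (mul_mem_polySpace hf.1 hg.1) (mul_mem_polySpace hf.2 hg.2)
  · have : (fun Q => (f Q * g Q).im) =
        (fun Q => (f Q).re) * (fun Q => (g Q).im) + (fun Q => (f Q).im) * (fun Q => (g Q).re) := by
      funext Q; simp [Complex.mul_im]
    rw [this]
    exact Submodule.add_mem _ (mul_mem_polySpace hf.1 hg.2) (mul_mem_polySpace hf.2 hg.1)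

omit [Fintype ι] [DecidableEq ι] in
/-- Finite sums of polynomial maps are polynomial. -/
theorem IsCPoly.sum {n : ℕ} {κ : Type*} (s : Finset κ) {f : κ → Cfg ι N → ℂ} (hf : ∀ k ∈ s, IsCPoly n (f k)) :
    IsCPoly n fun Q => ∑ k ∈ s, f k Q := by
  refine ⟨?_, ?_⟩
  · have : (fun Q => (∑ k ∈ s, f k Q).re) = ∑ k ∈ s, fun Q => (f k Q).re := by
      funext Q; simp [Complex.re_sum]
    rw [this]; exact Submodule.sum_mem _ fun k hk => (hf k hk).1
  · have : (fun Q => (∑ k ∈ s, f k Q).im) = ∑ k ∈ s, fun Q => (f k Q).im := by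
      funext Q; simp [Complex.im_sum]
    rw [this]; exact Submodule.sum_mem _ fun k hk => (hf k hk).2

omit [Fintype ι] [DecidableEq ι] in
/-- Degree monotonicity. -/
theorem IsCPoly.mono {n n' : ℕ} (h : n ≤ n') {f : Cfg ι N → ℂ} (hf : IsCPoly n f) : IsCPoly n' f :=
  ⟨polySpace_mono h hf.1, polySpace_mono h hf.2⟩

/-- A matrix-valued map is polynomial of degree `≤ n` if all its entries are. -/
def IsCPolyMat (n : ℕ) (F : Cfg ι N → Matrix (Fin N) (Fin N) ℂ) : Prop := ∀ i j, IsCPoly n fun Q => F Q i j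

omit [Fintype ι] [DecidableEq ι] in
/-- The link matrices `Q ↦ Q_e` are polynomial of degree `1`. -/
theorem isCPolyMat_link (e : ι) : IsCPolyMat (ι := ι) (N := N) 1 fun Q => Q e := fun a b => isCPoly_entry e a b

omit [Fintype ι] [DecidableEq ι] in
/-- Conjugate transposes of polynomial matrix maps are polynomial. -/
theorem IsCPolyMat.conjTranspose {n : ℕ} {F : Cfg ι N → Matrix (Fin N) (Fin N) ℂ} (hF : IsCPolyMat n F) :
    IsCPolyMat n fun Q => (F Q)ᴴ := fun i j => by
  have := (hF j i).conj
  simpa [Matrix.conjTranspose_apply] using this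

omit [Fintype ι] [DecidableEq ι] in
/-- Products of polynomial matrix maps are polynomial, degrees add. -/
theorem IsCPolyMat.mul {a b : ℕ} {F G : Cfg ι N → Matrix (Fin N) (Fin N) ℂ} (hF : IsCPolyMat a F)
    (hG : IsCPolyMat b G) : IsCPolyMat (a + b) fun Q => F Q * G Q := fun i j => by
  have : (fun Q => (F Q * G Q) i j) = fun Q => ∑ k, F Q i k * G Q k j := by
    funext Q; rw [Matrix.mul_apply]
  rw [this]
  exact IsCPoly.sum univ fun k _ => (hF i k).mul (hG k j)

omit [Fintype ι] [DecidableEq ι] in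
/-- Traces of polynomial matrix maps are polynomial; in particular their real parts lie in `𝒫_n`. -/
theorem IsCPolyMat.re_trace_mem {n : ℕ} {F : Cfg ι N → Matrix (Fin N) (Fin N) ℂ} (hF : IsCPolyMat n F) :
    (fun Q => ((F Q).trace).re) ∈ polySpace ι N n := by
  have h : IsCPoly n fun Q => (F Q).trace := by
    have : (fun Q => (F Q).trace) = fun Q => ∑ i, F Q i i := by
      funext Q; rw [Matrix.trace]; rfl
    rw [this]
    exact IsCPoly.sum univ fun i _ => hF i i
  exact h.1

omit [Fintype ι] [DecidableEq ι] in
/-- **The plaquette trace is a polynomial of degree `4`**: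
`Q ↦ Re tr(Q_{e₁} Q_{e₂} Q_{e₃}ᴴ Q_{e₄}ᴴ) ∈ 𝒫_4`. -/
theorem re_trace_plaquette_mem_polySpace (e₁ e₂ e₃ e₄ : ι) :
    (fun Q : Cfg ι N => (Q e₁ * Q e₂ * (Q e₃)ᴴ * (Q e₄)ᴴ).trace.re) ∈ polySpace ι N 4 := by
  have h : IsCPolyMat (ι := ι) (N := N) (1 + 1 + 1 + 1) fun Q => Q e₁ * Q e₂ * (Q e₃)ᴴ * (Q e₄)ᴴ :=
    (((isCPolyMat_link e₁).mul (isCPolyMat_link e₂)).mul (isCPolyMat_link e₃).conjTranspose).mul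
      (isCPolyMat_link e₄).conjTranspose
  exact h.re_trace_mem

end CPoly

/-! ### The Wilson action on the torus as a polynomial potential -/

section Wilson

variable {d N : ℕ} {L : ℕ} [NeZero L]

/-- The four positively oriented links of the plaquette `p = (x; i<j)` of the torus, in the order of
`plaquetteHolonomy`: `(x,i), (x+eᵢ,j), (x+eⱼ,i), (x,j)`. -/
def plaqLinks (p : Plaquette d L) : Edge d L × Edge d L × Edge d L × Edge d L :=
  ((p.1, p.2.1.1), (p.1.shift p.2.1.1, p.2.1.2), (p.1.shift p.2.1.2, p.2.1.1), (p.1, p.2.1.2))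

variable (d N L) in
/-- **The Wilson potential** at 't Hooft coupling `β` on the ambient algebra `(E⁺(Λ_L) → M_N(ℂ))`:
`S(Q) = Nβ ∑_p Re tr(Q_{(x,i)} Q_{(x+eᵢ,j)} Q_{(x+eⱼ,i)}ᴴ Q_{(x,j)}ᴴ)` — on `SU(N)^E` this is
`Nβ ∑_p Re tr U_p`, Shen–Zhu–Zhu's `𝒮` ((1.1), tree coupling `Nβ`). -/
def wilsonPot (β : ℝ) : Cfg (Edge d L) N → ℝ := fun Q =>
  (N : ℝ) * β * ∑ p : Plaquette d L,
    (Q (plaqLinks p).1 * Q (plaqLinks p).2.1 * (Q (plaqLinks p).2.2.1)ᴴ * (Q (plaqLinks p).2.2.2)ᴴ).trace.re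

variable (d N L) in
/-- The normalised Wilson potential `∑_p Re tr(…)` (without the factor `Nβ`). -/
def wilsonPot₀ : Cfg (Edge d L) N → ℝ := fun Q =>
  ∑ p : Plaquette d L,
    (Q (plaqLinks p).1 * Q (plaqLinks p).2.1 * (Q (plaqLinks p).2.2.1)ᴴ * (Q (plaqLinks p).2.2.2)ᴴ).trace.re

/-- `wilsonPot β = Nβ · wilsonPot₀`. -/
theorem wilsonPot_eq (β : ℝ) : wilsonPot d N L β = fun Q => (N : ℝ) * β * wilsonPot₀ d N L Q := rfl

/-- `wilsonPot₀ ∈ 𝒫_4`. -/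
theorem wilsonPot₀_mem_polySpace : wilsonPot₀ d N L ∈ polySpace (Edge d L) N 4 := by
  have : wilsonPot₀ d N L = ∑ p : Plaquette d L, fun Q : Cfg (Edge d L) N =>
      (Q (plaqLinks p).1 * Q (plaqLinks p).2.1 * (Q (plaqLinks p).2.2.1)ᴴ * (Q (plaqLinks p).2.2.2)ᴴ).trace.re := by
    funext Q; simp only [wilsonPot₀, Finset.sum_apply]
  rw [this]
  exact Submodule.sum_mem _ fun p _ => re_trace_plaquette_mem_polySpace _ _ _ _

/-- **The Wilson potential is a polynomial of degree `≤ 4`** in the real coordinates. -/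
theorem wilsonPot_mem_polySpace (β : ℝ) : wilsonPot d N L β ∈ polySpace (Edge d L) N 4 := by
  have : wilsonPot d N L β = ((N : ℝ) * β) • wilsonPot₀ d N L := by
    funext Q; simp only [wilsonPot_eq, Pi.smul_apply, smul_eq_mul]
  rw [this]
  exact Submodule.smul_mem _ _ wilsonPot₀_mem_polySpace

/-- The Wilson potential is smooth. -/
theorem contDiff_wilsonPot (β : ℝ) : ContDiff ℝ ∞ (wilsonPot d N L β) :=
  contDiff_of_mem_polySpace (wilsonPot_mem_polySpace β)

/-- **On `SU(N)^E`, `-(Nβ) S_W(U) = wilsonPot β (U) - N²β |P|`** (`S_W = ∑_p (N - Re tr U_p)` the tree's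
`wilsonAction` for the fundamental representation; `U⁻¹ = Uᴴ` in `SU(N)`). -/
theorem neg_mul_wilsonAction_eq (β : ℝ) (U : GaugeConfig d L (SUN N)) :
    -((N : ℝ) * β) * wilsonAction (fundamentalRep (Fin N)) U =
      wilsonPot d N L β (emb U) - (N : ℝ) * β * N * Fintype.card (Plaquette d L) := by
  have hp : ∀ p : Plaquette d L, (fundamentalRep (Fin N) (plaquetteHolonomy U p.1 p.2.1.1 p.2.1.2)).trace.re =
      (emb U (plaqLinks p).1 * emb U (plaqLinks p).2.1 * (emb U (plaqLinks p).2.2.1)ᴴ *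
        (emb U (plaqLinks p).2.2.2)ᴴ).trace.re := by
    intro p
    simp only [plaquetteHolonomy, map_mul, plaqLinks, emb_apply]
    rfl
  simp only [wilsonAction, wilsonPot, hp, Finset.sum_sub_distrib, Finset.sum_const, Finset.card_univ,
    nsmul_eq_mul]
  ring

/-- The Wilson Boltzmann weight at tree coupling `Nβ` is `e^{wilsonPot}` times a positive constant. -/
theorem exp_neg_mul_wilsonAction_eq (β : ℝ) (U : GaugeConfig d L (SUN N)) :
    Real.exp (-((N : ℝ) * β) * wilsonAction (fundamentalRep (Fin N)) U) =
      Real.exp (-((N : ℝ) * β * N * Fintype.card (Plaquette d L))) * Real.exp (wilsonPot d N L β (emb U)) := by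
  rw [neg_mul_wilsonAction_eq, ← Real.exp_add]
  congr 1
  ring

/-! ### The Hessian hypothesis from the tree's `WilsonHessianBound` -/

/-- Along the right flow `t ↦ Q e^{tV}` at `Q ∈ SU(N)^E`, the normalised Wilson potential is the tree's
`wilsonPlaquetteSumAlong Q X` with the conjugated (left) directions `X_e = Q_e V_e Q_eᴴ`. -/
theorem wilsonPot₀_emb_mul_exp (g : PSU (Edge d L) N) (V : Cfg (Edge d L) N) (t : ℝ) :
    wilsonPot₀ d N L (emb g * NormedSpace.exp (t • V)) =
      wilsonPlaquetteSumAlong g (fun e => (g e : Matrix (Fin N) (Fin N) ℂ) * V e * (g e : Matrix (Fin N) (Fin N) ℂ)ᴴ) t := by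
  -- linkwise: `g_e exp(tV_e) = exp(t g_e V_e g_eᴴ) g_e`
  have hlink : ∀ e : Edge d L, (emb g * NormedSpace.exp (t • V)) e =
      NormedSpace.exp (t • ((g e : Matrix (Fin N) (Fin N) ℂ) * V e * (g e : Matrix (Fin N) (Fin N) ℂ)ᴴ)) *
        (g e : Matrix (Fin N) (Fin N) ℂ) := by
    intro e
    rw [Pi.mul_apply, show NormedSpace.exp (t • V) = fun e => NormedSpace.exp ((t • V) e) from Pi.exp_def _]
    simp only [Pi.smul_apply, emb_apply]
    set Ug : Matrix (Fin N) (Fin N) ℂ := (g e : Matrix (Fin N) (Fin N) ℂ) with hUg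
    have hUu : Ug ∈ Matrix.unitaryGroup (Fin N) ℂ := Matrix.specialUnitaryGroup_le_unitaryGroup (g e).2
    have hstar : star Ug * Ug = 1 := Unitary.star_mul_self_of_mem hUu
    have hstar' : Ug * star Ug = 1 := Unitary.mul_star_self_of_mem hUu
    have hunit : IsUnit Ug := ⟨⟨Ug, star Ug, hstar', hstar⟩, rfl⟩
    have hinv : Ug⁻¹ = star Ug := Matrix.inv_eq_left_inv hstar
    have hconj : t • (Ug * V e * Ugᴴ) = Ug * (t • V e) * Ug⁻¹ := by
      rw [hinv, Matrix.star_eq_conjTranspose, Matrix.mul_smul, Matrix.smul_mul]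
    rw [hconj, Matrix.exp_conj Ug (t • V e) hunit, hinv, Matrix.star_eq_conjTranspose, Matrix.mul_assoc,
      Matrix.mul_assoc, show Ugᴴ * Ug = 1 from hstar, Matrix.mul_one]
  simp only [wilsonPot₀, wilsonPlaquetteSumAlong, plaqLinks, hlink]

/-- The second derivative along the right flow `s ↦ Q e^{sV}` at `Q ∈ SU(N)^E` is `D_V D_V F (Q)`
(`iteratedDeriv_two_comp_mul_exp`, restated with the flow written in the product algebra). -/
theorem iteratedDeriv_two_emb_mul_exp {ι : Type u} [Fintype ι] [DecidableEq ι] {F : Cfg ι N → ℝ}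
    (hF : ContDiff ℝ ∞ F) (g : PSU ι N) (V : Cfg ι N) :
    iteratedDeriv 2 (fun s : ℝ => F (emb g * NormedSpace.exp (s • V))) 0 = algD V (algD V F) (emb g) :=
  iteratedDeriv_two_comp_mul_exp hF (emb g) V

/-- Frobenius norms are invariant under unitary conjugation: `‖g V gᴴ‖_F = ‖V‖_F`. -/
theorem frobNorm_conj_unitary {g : Matrix (Fin N) (Fin N) ℂ} (hg : g ∈ Matrix.unitaryGroup (Fin N) ℂ)
    (V : Matrix (Fin N) (Fin N) ℂ) : frobNorm (g * V * gᴴ) = frobNorm V := by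
  have hg' : gᴴ ∈ Matrix.unitaryGroup (Fin N) ℂ := by
    rw [← Matrix.star_eq_conjTranspose]; exact Unitary.star_mem hg
  rw [frobNorm_mul_unitary _ hg', frobNorm_unitary_mul hg]

/-- `tangentSqNorm X = ∑_e ‖X_e‖_F²`. -/
theorem tangentSqNorm_eq_sum_frobNorm_sq (X : Edge d L → Matrix (Fin N) (Fin N) ℂ) :
    tangentSqNorm X = ∑ e, frobNorm (X e) ^ 2 := by
  unfold tangentSqNorm
  refine sum_congr rfl fun e _ => ?_
  rw [frobNorm_sq_eq_re_trace, Matrix.trace_mul_comm]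

/-- **The Hessian hypothesis of the multi-link Bakry–Émery theorem for the Wilson potential**: the
tree's torus Hessian bound `WilsonHessianBound d N Λ₀` (`|d²/dt² ∑_p Re tr hol_p(e^{tX}Q)| ≤ Λ₀ |X|²`)
gives `HessBound (wilsonPot β) (N|β|Λ₀)`. -/
theorem hessBound_wilsonPot {Λ₀ : ℝ} (hH : WilsonHessianBound d N Λ₀) (β : ℝ) :
    HessBound (wilsonPot d N L β) ((N : ℝ) * |β| * Λ₀) := by
  intro g V hV hV0
  set X : Edge d L → Matrix (Fin N) (Fin N) ℂ :=
    fun e => (g e : Matrix (Fin N) (Fin N) ℂ) * V e * (g e : Matrix (Fin N) (Fin N) ℂ)ᴴ with hX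
  have hXskew : ∀ e, (X e)ᴴ = -X e := by
    intro e
    simp only [hX, conjTranspose_mul, conjTranspose_conjTranspose, hV e, Matrix.mul_neg, Matrix.neg_mul,
      Matrix.mul_assoc]
  have hXtr : ∀ e, (X e).trace = 0 := by
    intro e
    simp only [hX]
    rw [Matrix.mul_assoc, Matrix.trace_mul_comm, Matrix.mul_assoc,
      show (g e : Matrix (Fin N) (Fin N) ℂ)ᴴ * (g e : Matrix (Fin N) (Fin N) ℂ) = 1 from
        Unitary.star_mul_self_of_mem (Matrix.specialUnitaryGroup_le_unitaryGroup (g e).2), Matrix.mul_one, hV0 e]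
  -- second derivative of the normalised potential along the flow = the tree's second derivative
  have hflow : (fun s : ℝ => wilsonPot₀ d N L (emb g * NormedSpace.exp (s • V))) = wilsonPlaquetteSumAlong g X :=
    funext fun s => wilsonPot₀_emb_mul_exp g V s
  have h0 : algD V (algD V (wilsonPot₀ d N L)) (emb g) = iteratedDeriv 2 (wilsonPlaquetteSumAlong g X) 0 := by
    rw [← iteratedDeriv_two_emb_mul_exp (contDiff_of_mem_polySpace wilsonPot₀_mem_polySpace) g V, hflow]
  -- scale by `Nβ`
  have h1 : algD V (algD V (wilsonPot d N L β)) (emb g) = (N : ℝ) * β * iteratedDeriv 2 (wilsonPlaquetteSumAlong g X) 0 := by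
    have hc0 : ContDiff ℝ ∞ (wilsonPot₀ d N L) := contDiff_of_mem_polySpace wilsonPot₀_mem_polySpace
    rw [wilsonPot_eq, algD_const_mul hc0, algD_const_mul (contDiff_algD hc0 V)]
    show (N : ℝ) * β * algD V (algD V (wilsonPot₀ d N L)) (emb g) = _
    rw [h0]
  rw [h1, abs_mul, abs_mul, Nat.abs_cast]
  have hb := hH L g X hXskew hXtr
  have hnorm : tangentSqNorm X = ∑ e, frobNorm (V e) ^ 2 := by
    rw [tangentSqNorm_eq_sum_frobNorm_sq]
    exact sum_congr rfl fun e _ => by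
      rw [hX, frobNorm_conj_unitary (Matrix.specialUnitaryGroup_le_unitaryGroup (g e).2)]
  rw [hnorm] at hb
  calc (N : ℝ) * |β| * |iteratedDeriv 2 (wilsonPlaquetteSumAlong g X) 0|
      ≤ (N : ℝ) * |β| * (Λ₀ * ∑ e, frobNorm (V e) ^ 2) :=
        mul_le_mul_of_nonneg_left hb (mul_nonneg (Nat.cast_nonneg _) (abs_nonneg _))
    _ = (N : ℝ) * |β| * Λ₀ * ∑ e, frobNorm (V e) ^ 2 := by ring

end Wilson

end LatticeBakryEmery

end Summit.Ventures.YMGap
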